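import Mathlib
import Literature.AlgebraicGeometry.Modules.FiniteType
import Literature.AlgebraicGeometry.Modules.AffineLocalizing
import Literature.AlgebraicGeometry.Morphisms.DevissageClass
import Summits.ResolutionOfSingularities.ResolutionOfSingularities.Theorems.HomologicalConductorNoZenoFullSheaf
import HarnessLib

/-!
# Crux `NoZenoR` (stmt-ResolutionOfSingularities-19943), line `sandwich-cluster`, G-layer:
# sections of `𝒪_X · S` over AFFINE opens, and coherence (affine-localizing + finite type)

OURS (cell res-hironaka, chain W4.4; KERNEL-L0 §16 R6 row G2 «full-sheaf package», seat res-D-pv-045 AS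
res-L0-w44-stub-8). Sequel of `…Theorems.HomologicalConductorNoZenoFullSheaf` (the object
`generatedSheaf V S : X.Modules` = «`𝒪_X · S ⊆ V_X`», `X` integral, `V` a `K(X)`-vector space, `S ⊆ V`).
Nothing of [claim: Hironaka2017] is used.

Main results (everything proved; no named facts):

* `baseModule` — `V` as a `Γ(X, U)`-module through `Γ(X, U) → K(X)` (`U ≠ ∅`), compatible with the
  stalk actions (`base_smul_eq_germ_smul`) and with `evalFn` (`evalFn_smul_eq_base_smul`);
  `span_le_stalkSpan` — `Γ(X, U) · S ⊆ 𝒪_{X,x} · S` for `x ∈ U`;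
* **`iInter_stalkSpan_eq_span`** — for `U` AFFINE (non-empty): `⋂_{x ∈ U} 𝒪_{X,x} · S = Γ(X, U) · S`
  (if `v` lies in every stalk lattice, the ideal `{b : b • v ∈ Γ(X,U)·S}` is contained in no prime
  `𝔭`, because `𝒪_{X,x_𝔭} = Γ(X,U)_𝔭` lets one clear denominators — `exists_not_mem_smul_mem_span`,
  Mathlib `IsAffineOpen.isLocalization_stalk'`);
* **`sectionsEquivSpan`** — hence `Γ(U, 𝒪_X · S) ≃ₗ[Γ(X, U)] Γ(X, U) · S` for affine `U ∋ x` (the value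
  map at `x`; `range_fn_apply_eq_span`, `fn_mem_span`, `exists_fn_apply_eq`): «on affines the full sheaf
  `M~ = π^*M/torsion` has sections `𝒪_X(U) · M`» (Artin–Verdier 1985, p. 79);
* `isAffineFiniteType_generatedSheaf` — for finite `S`, `𝒪_X · S` is of affine-finite type;
* `exists_pow_smul_mem_span`, **`isAffineLocalizing_generatedSheaf`** — `𝒪_X · S` is affine-localizing
  (EGA I 1.4.1 d1/d2: numerators on `D(r)` by clearing powers of `r`, `Γ(X, D(r)) = Γ(X, U)_r`; torsion
  trivially, restriction being injective); hence **`coh_generatedSheaf`** — `𝒪_X · S` is coherent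
  (`Morphisms/DevissageClass.Coh`) for finite `S`, so that the tree's dévissage / finiteness of `Ȟ⁰, Ȟ¹`
  (`Morphisms/Devissage`, `DevissageHeart`) apply to full sheaves and ideal sheaves `I · 𝒪_X`.

References: M. Artin, J.-L. Verdier, Math. Ann. 270 (1985) 79–82, p. 79 [`ArtinVerdier1985`];
A. Grothendieck, J. Dieudonné, EGA I (1971), Thm. 1.4.1 [`EGA1`]; R. Hartshorne, *Algebraic Geometry*
(1977), II Lemma 5.3 [`Hartshorne1977`].
-/

-- single-problem summit: the doubled namespace component `ResolutionOfSingularities` is forced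
set_option linter.dupNamespace false

noncomputable section

universe u

open CategoryTheory AlgebraicGeometry TopologicalSpace Opposite

namespace Summit.ResolutionOfSingularities.ResolutionOfSingularities.Theorems.NoZeno.SandwichCluster.FullSheaf

variable {X : Scheme.{u}} [IsIntegral X]
variable (V : Type u) [AddCommGroup V] [Module X.functionField V] (S : Set V)

attribute [local instance] stalkModule stalk_isScalarTower fnModule

/-! ## `V` as a `Γ(X, U)`-module, `U` non-empty -/

/-- `V` as a `Γ(X, U)`-module through `Γ(X, U) → K(X)` (Mathlib `Scheme.germToFunctionField`),
for a non-empty open `U`. [folklore] -/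
@[reducible]
def baseModule (U : X.Opens) [Nonempty U] : Module Γ(X, U) V :=
  Module.compHom V (X.germToFunctionField U).hom

attribute [local instance] baseModule

/-- Unfolding: `g • v = g|_{K(X)} • v`. [folklore] -/
theorem base_smul_def (U : X.Opens) [Nonempty U] (g : Γ(X, U)) (v : V) :
    g • v = X.germToFunctionField U g • v := rfl

/-- The `Γ(X, U)`-action factors through every stalk: `g • v = (g)_x • v` for `x ∈ U`. [folklore] -/
theorem base_smul_eq_germ_smul (U : X.Opens) [Nonempty U] {x : X} (hx : x ∈ U) (g : Γ(X, U)) (v : V) :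
    g • v = (X.presheaf.germ U x hx g) • v := by
  rw [base_smul_def, stalk_smul_def, Scheme.algebraMap_germ_eq_germToFunctionField]

/-- The `Γ(X, U)`-action through `evalFn U x` is the same action. [folklore] -/
theorem evalFn_smul_eq_base_smul (U : X.Opens) [Nonempty U] (x : U) (g : Γ(X, U)) (v : V) :
    evalFn U x g • v = g • v := by
  rw [evalFn_eq_germToFunctionField, base_smul_def]

/-- `Γ(X, U) → 𝒪_{X,x} → End V` is a scalar tower (`x ∈ U`). [folklore] -/
theorem base_isScalarTower (U : X.Opens) [Nonempty U] {x : X} (hx : x ∈ U) :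
    @IsScalarTower Γ(X, U) (X.presheaf.stalk x) V
      (TopCat.Presheaf.algebra_section_stalk X.presheaf ⟨x, hx⟩).toSMul _ _ := by
  letI := TopCat.Presheaf.algebra_section_stalk X.presheaf (⟨x, hx⟩ : U)
  refine ⟨fun g t v => ?_⟩
  change (X.presheaf.germ U x hx g * t) • v = g • t • v
  rw [mul_smul, base_smul_eq_germ_smul V U hx]

/-- `Γ(X, U) · S ⊆ 𝒪_{X,x} · S` for `x ∈ U`. [folklore] -/
theorem span_le_stalkSpan (U : X.Opens) [Nonempty U] {x : X} (hx : x ∈ U) :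
    ((Submodule.span Γ(X, U) S : Submodule Γ(X, U) V) : Set V) ⊆ (stalkSpan V S x : Set V) := by
  intro v hv
  induction hv using Submodule.span_induction with
  | mem w hw => exact subset_stalkSpan V S x hw
  | zero => exact (stalkSpan V S x).zero_mem
  | add w w' _ _ hw hw' => exact (stalkSpan V S x).add_mem hw hw'
  | smul g w _ hw =>
    rw [SetLike.mem_coe, base_smul_eq_germ_smul V U hx]
    exact (stalkSpan V S x).smul_mem _ hw

/-! ## Affine opens: `⋂_{x ∈ U} 𝒪_{X,x} · S = Γ(X, U) · S` -/

/-- **Key step** (`U` affine): if `v ∈ 𝒪_{X,x} · S` at the point `x ∈ U` corresponding to a prime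
`𝔭 ⊆ Γ(X, U)`, then `b • v ∈ Γ(X, U) · S` for some `b ∉ 𝔭` (clear the denominators of the
coefficients, `𝒪_{X,x} = Γ(X, U)_𝔭`, Mathlib `IsAffineOpen.isLocalization_stalk'`). [folklore] -/
theorem exists_not_mem_smul_mem_span {U : X.Opens} (hU : IsAffineOpen U)
    [Nonempty U] (y : PrimeSpectrum Γ(X, U)) (v : V) (hv : v ∈ stalkSpan V S (hU.fromSpec y)) :
    ∃ b : Γ(X, U), b ∉ y.asIdeal ∧ b • v ∈ Submodule.span Γ(X, U) S := by
  have hyU : (hU.fromSpec y : X) ∈ U := by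
    have h := Set.mem_range_self (f := fun p => (hU.fromSpec p : X)) y
    rwa [hU.range_fromSpec] at h
  letI := TopCat.Presheaf.algebra_section_stalk X.presheaf (⟨_, hyU⟩ : U)
  have hloc := hU.isLocalization_stalk' y hyU
  have h1 : (1 : Γ(X, U)) ∉ y.asIdeal := (Ideal.ne_top_iff_one _).mp y.2.ne_top
  induction hv using Submodule.span_induction with
  | mem w hw => exact ⟨1, h1, by rw [one_smul]; exact Submodule.subset_span hw⟩
  | zero => exact ⟨1, h1, by rw [smul_zero]; exact Submodule.zero_mem _⟩
  | add w w' _ _ hw hw' =>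
    obtain ⟨b, hb, hbw⟩ := hw
    obtain ⟨b', hb', hbw'⟩ := hw'
    refine ⟨b * b', fun h => (y.2.mem_or_mem h).elim hb hb', ?_⟩
    rw [smul_add]
    refine Submodule.add_mem _ ?_ ?_
    · rw [mul_comm, mul_smul]
      exact Submodule.smul_mem _ _ hbw
    · rw [mul_smul]
      exact Submodule.smul_mem _ _ hbw'
  | smul t w _ hw =>
    obtain ⟨b, hb, hbw⟩ := hw
    obtain ⟨⟨a, s⟩, hts⟩ := @IsLocalization.surj Γ(X, U) _ y.asIdeal.primeCompl
      (X.presheaf.stalk (hU.fromSpec y)) _ (TopCat.Presheaf.algebra_section_stalk X.presheaf ⟨_, hyU⟩) hloc t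
    -- `t * s = a` in the stalk; take `b' = s * b`
    refine ⟨(s : Γ(X, U)) * b, fun h => (y.2.mem_or_mem h).elim s.2 hb, ?_⟩
    have key : ((s : Γ(X, U)) * b) • t • w = a • b • w := by
      rw [base_smul_eq_germ_smul V U hyU, base_smul_eq_germ_smul V U hyU a,
        base_smul_eq_germ_smul V U hyU b, ← mul_smul, ← mul_smul]
      congr 1
      have hts' : t * X.presheaf.germ U _ hyU (s : Γ(X, U)) = X.presheaf.germ U _ hyU a := hts
      rw [map_mul]
      calc X.presheaf.germ U _ hyU ↑s * X.presheaf.germ U _ hyU b * t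
          = X.presheaf.germ U _ hyU b * (t * X.presheaf.germ U _ hyU ↑s) := by ring
        _ = X.presheaf.germ U _ hyU b * X.presheaf.germ U _ hyU a := by rw [hts']
        _ = X.presheaf.germ U _ hyU a * X.presheaf.germ U _ hyU b := by ring
    rw [key]
    exact Submodule.smul_mem _ _ hbw

/-- **Sections of `𝒪_X · S` over an AFFINE open are the `Γ(X, U)`-span of `S`**:
`⋂_{x ∈ U} 𝒪_{X,x} · S = Γ(X, U) · S` (`U` affine, non-empty). Proof: for `v` in the intersection,
the ideal `{b : b • v ∈ Γ(X,U) · S}` lies in no prime of `Γ(X, U)`. [folklore] -/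
theorem iInter_stalkSpan_eq_span {U : X.Opens} (hU : IsAffineOpen U) [Nonempty U] :
    (⋂ x : U, (stalkSpan V S x.1 : Set V)) = (Submodule.span Γ(X, U) S : Set V) := by
  refine Set.Subset.antisymm ?_ ?_
  · intro v hv
    rw [Set.mem_iInter] at hv
    -- the ideal of multipliers taking `v` into the span
    let J : Ideal Γ(X, U) := (Submodule.span Γ(X, U) S).comap (LinearMap.toSpanSingleton Γ(X, U) V v)
    have hJ : ∀ b : Γ(X, U), b ∈ J ↔ b • v ∈ Submodule.span Γ(X, U) S := fun b => by
      simp [J, LinearMap.toSpanSingleton_apply]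
    suffices hJtop : J = ⊤ by
      have h1 : (1 : Γ(X, U)) ∈ J := hJtop ▸ Submodule.mem_top
      rw [hJ, one_smul] at h1
      exact h1
    by_contra hJtop
    obtain ⟨𝔪, h𝔪, hJ𝔪⟩ := Ideal.exists_le_maximal J hJtop
    let y : PrimeSpectrum Γ(X, U) := ⟨𝔪, h𝔪.isPrime⟩
    have hyU : (hU.fromSpec y : X) ∈ U := by
      have h := Set.mem_range_self (f := fun p => (hU.fromSpec p : X)) y
      rwa [hU.range_fromSpec] at h
    obtain ⟨b, hb, hbv⟩ := exists_not_mem_smul_mem_span V S hU y v (hv ⟨_, hyU⟩)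
    exact hb (hJ𝔪 ((hJ b).mpr hbv))
  · rintro v hv
    exact Set.mem_iInter.mpr fun x => span_le_stalkSpan V S U x.2 hv

/-- **`Γ(U, 𝒪_X · S) = Γ(X, U) · S` for `U` affine**: the values of the sections of the generated
sheaf over an affine open containing `x` are exactly the `Γ(X, U)`-span of `S`. [folklore] -/
theorem range_fn_apply_eq_span {U : X.Opens} (hU : IsAffineOpen U) [Nonempty U] (x : U) :
    Set.range (fun s : Γ(generatedSheaf V S, U) => fn V S s x) = (Submodule.span Γ(X, U) S : Set V) := by
  rw [range_fn_apply, iInter_stalkSpan_eq_span V S hU]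

/-- The value of a section over an affine open lies in `Γ(X, U) · S`. [folklore] -/
theorem fn_mem_span {U : X.Opens} (hU : IsAffineOpen U) [Nonempty U] (s : Γ(generatedSheaf V S, U))
    (x : U) : fn V S s x ∈ Submodule.span Γ(X, U) S := by
  have h : fn V S s x ∈ Set.range (fun s : Γ(generatedSheaf V S, U) => fn V S s x) := Set.mem_range_self s
  rw [range_fn_apply_eq_span V S hU x] at h
  exact h

/-- Every element of `Γ(X, U) · S` is the value of a (unique) section over the affine `U`. [folklore] -/
theorem exists_fn_apply_eq {U : X.Opens} (hU : IsAffineOpen U) [Nonempty U] (x : U) (v : V)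
    (hv : v ∈ Submodule.span Γ(X, U) S) : ∃ s : Γ(generatedSheaf V S, U), fn V S s x = v := by
  have h : v ∈ Set.range (fun s : Γ(generatedSheaf V S, U) => fn V S s x) := by
    rw [range_fn_apply_eq_span V S hU x]; exact hv
  exact h

/-- The value map `Γ(U, 𝒪_X · S) → Γ(X, U) · S` at `x ∈ U` (`U` affine), `Γ(X, U)`-linear.
[folklore] -/
def sectionsToSpan {U : X.Opens} (hU : IsAffineOpen U) [Nonempty U] (x : U) :
    Γ(generatedSheaf V S, U) →ₗ[Γ(X, U)] (Submodule.span Γ(X, U) S : Submodule Γ(X, U) V) where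
  toFun s := ⟨fn V S s x, fn_mem_span V S hU s x⟩
  map_add' _ _ := rfl
  map_smul' g s := by
    apply Subtype.ext
    show fn V S (g • s) x = g • fn V S s x
    rw [fn_smul, evalFn_smul_eq_base_smul]

/-- The value map is bijective onto `Γ(X, U) · S` (`U` affine). [folklore] -/
theorem sectionsToSpan_bijective {U : X.Opens} (hU : IsAffineOpen U) [Nonempty U] (x : U) :
    Function.Bijective (sectionsToSpan V S hU x) :=
  ⟨fun s s' h => fn_apply_injective V S x (congrArg Subtype.val h),
    fun ⟨v, hv⟩ => by
      obtain ⟨s, hs⟩ := exists_fn_apply_eq V S hU x v hv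
      exact ⟨s, Subtype.ext hs⟩⟩

/-- **The value map `Γ(U, 𝒪_X · S) ≃ₗ Γ(X, U) · S`** at a point `x` of the affine open `U`,
`Γ(X, U)`-linear. [folklore] -/
def sectionsEquivSpan {U : X.Opens} (hU : IsAffineOpen U) [Nonempty U] (x : U) :
    Γ(generatedSheaf V S, U) ≃ₗ[Γ(X, U)] (Submodule.span Γ(X, U) S : Submodule Γ(X, U) V) :=
  LinearEquiv.ofBijective (sectionsToSpan V S hU x) (sectionsToSpan_bijective V S hU x)

/-- Unfolding of `sectionsEquivSpan`. [folklore] -/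
@[simp]
theorem coe_sectionsEquivSpan {U : X.Opens} (hU : IsAffineOpen U) [Nonempty U] (x : U)
    (s : Γ(generatedSheaf V S, U)) : (sectionsEquivSpan V S hU x s : V) = fn V S s x := rfl

/-- **Finite type**: for finite `S`, the sections of `𝒪_X · S` over every affine open form a finitely
generated `Γ(X, U)`-module (`Modules/FiniteType.IsAffineFiniteType`). [folklore] -/
theorem isAffineFiniteType_generatedSheaf (hS : S.Finite) :
    Literature.AlgebraicGeometry.Modules.IsAffineFiniteType (generatedSheaf (X := X) V S) := by
  intro U hU
  rcases isEmpty_or_nonempty U with hUe | ⟨⟨x⟩⟩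
  · -- over the empty open every section is `0`
    refine ⟨⟨∅, ?_⟩⟩
    rw [Finset.coe_empty, Submodule.span_empty]
    refine le_antisymm bot_le fun s _ => ?_
    rw [Submodule.mem_bot]
    exact section_ext V S (funext fun y => (hUe.false y).elim)
  · haveI : Nonempty U := ⟨x⟩
    haveI : Module.Finite Γ(X, U) (Submodule.span Γ(X, U) S : Submodule Γ(X, U) V) :=
      ⟨(Submodule.fg_top _).mpr (Submodule.fg_def.mpr ⟨S, hS, rfl⟩)⟩
    exact Module.Finite.equiv (sectionsEquivSpan V S hU x).symm

end Summit.ResolutionOfSingularities.ResolutionOfSingularities.Theorems.NoZeno.SandwichCluster.FullSheaf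

namespace Summit.ResolutionOfSingularities.ResolutionOfSingularities.Theorems.NoZeno.SandwichCluster.FullSheaf

variable {X : Scheme.{u}} [IsIntegral X]
variable (V : Type u) [AddCommGroup V] [Module X.functionField V] (S : Set V)

attribute [local instance] stalkModule stalk_isScalarTower fnModule baseModule

/-! ## `𝒪_X · S` is affine-localizing (quasi-coherent in the sense of EGA I 1.4.1) -/

/-- Over an empty open every section of `𝒪_X · S` vanishes. [folklore] -/
theorem section_eq_zero_of_isEmpty {U : X.Opens} (hU : IsEmpty U) (s : Γ(generatedSheaf V S, U)) : s = 0 :=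
  section_ext V S (funext fun y => (hU.false y).elim)

/-- A section vanishing on a NON-EMPTY smaller open vanishes (restriction of `𝒪_X · S` is injective:
the sections are constant functions). [folklore] -/
theorem eq_zero_of_map_eq_zero {U W : X.Opens} (i : W ⟶ U) (y : W) (s : Γ(generatedSheaf V S, U))
    (hs : (generatedSheaf V S).presheaf.map i.op s = 0) : s = 0 := by
  apply fn_apply_injective V S ⟨y.1, i.le y.2⟩
  change fn V S s ⟨y.1, i.le y.2⟩ = fn V S 0 ⟨y.1, i.le y.2⟩
  rw [← fn_map V S i s y, hs]
  rfl

/-- `Γ(X, U) → K(X)` is compatible with restriction. [folklore] -/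
theorem germToFunctionField_map {U W : X.Opens} (h : W ≤ U) [Nonempty W] [Nonempty U] (g : Γ(X, U)) :
    X.germToFunctionField W (X.presheaf.map (homOfLE h).op g) = X.germToFunctionField U g := by
  obtain ⟨y⟩ := ‹Nonempty W›
  rw [← evalFn_eq_germToFunctionField W y, evalFn_map h y g, evalFn_eq_germToFunctionField]

/-- **Numerators on a basic open**: for `U` affine, `r ∈ Γ(X, U)` and `v ∈ Γ(X, D(r)) · S`, some
`r^n • v` lies in `Γ(X, U) · S` (clear the denominators `r^m` of the coefficients,
`Γ(X, D(r)) = Γ(X, U)_r`). [folklore] -/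
theorem exists_pow_smul_mem_span {U : X.Opens} (hU : IsAffineOpen U) (r : Γ(X, U))
    [Nonempty (X.basicOpen r)] [Nonempty U] (v : V)
    (hv : v ∈ Submodule.span Γ(X, X.basicOpen r) S) :
    ∃ n : ℕ, (r ^ n) • v ∈ Submodule.span Γ(X, U) S := by
  have hloc := hU.isLocalization_basicOpen r
  -- the two actions on `V` through `K(X)`
  have hres : ∀ (a : Γ(X, U)) (w : V),
      (X.presheaf.map (homOfLE (X.basicOpen_le r)).op a) • w = a • w := fun a w => by
    rw [base_smul_def, base_smul_def, germToFunctionField_map]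
  induction hv using Submodule.span_induction with
  | mem w hw => exact ⟨0, by rw [pow_zero, one_smul]; exact Submodule.subset_span hw⟩
  | zero => exact ⟨0, by rw [smul_zero]; exact Submodule.zero_mem _⟩
  | add w w' _ _ hw hw' =>
    obtain ⟨n, hn⟩ := hw
    obtain ⟨n', hn'⟩ := hw'
    refine ⟨n + n', ?_⟩
    rw [smul_add]
    refine Submodule.add_mem _ ?_ ?_
    · rw [pow_add, mul_comm, mul_smul]
      exact Submodule.smul_mem _ _ hn
    · rw [pow_add, mul_smul]
      exact Submodule.smul_mem _ _ hn'
  | smul g w _ hw =>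
    obtain ⟨n, hn⟩ := hw
    obtain ⟨⟨a, s⟩, hgs⟩ := @IsLocalization.surj Γ(X, U) _ (Submonoid.powers r)
      Γ(X, X.basicOpen r) _ _ hloc g
    obtain ⟨m, hm⟩ := (Submonoid.mem_powers_iff _ _).mp s.2
    -- `g * r^m|_{D(r)} = a|_{D(r)}`
    have hgs' : g * X.presheaf.map (homOfLE (X.basicOpen_le r)).op (r ^ m) =
        X.presheaf.map (homOfLE (X.basicOpen_le r)).op a := by
      rw [hm]; exact hgs
    refine ⟨m + n, ?_⟩
    have key : (r ^ (m + n)) • g • w = a • (r ^ n) • w := by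
      rw [pow_add, ← hres (r ^ m * r ^ n), map_mul, mul_comm, mul_smul, ← mul_smul _ g, mul_comm _ g,
        hgs', hres, hres, ← mul_smul, ← mul_smul, mul_comm]
    rw [key]
    exact Submodule.smul_mem _ _ hn

/-- **`𝒪_X · S` is affine-localizing** (`Modules/AffineLocalizing.IsAffineLocalizing`: numerators and
torsion on the basic opens of affine opens). Torsion is trivial — restriction of `𝒪_X · S` is
injective — and numerators come from `exists_pow_smul_mem_span`. [folklore] -/
theorem isAffineLocalizing_generatedSheaf :
    Literature.AlgebraicGeometry.Modules.IsAffineLocalizing (generatedSheaf (X := X) V S) := by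
  constructor
  · intro U hU r W hW s
    subst hW
    rcases isEmpty_or_nonempty (X.basicOpen r) with hWe | ⟨⟨y⟩⟩
    · refine ⟨0, 0, ?_⟩
      rw [map_zero, pow_zero, one_smul, section_eq_zero_of_isEmpty V S hWe s]
    · haveI : Nonempty (X.basicOpen r) := ⟨y⟩
      haveI : Nonempty U := ⟨⟨y.1, X.basicOpen_le r y.2⟩⟩
      have hWaff : IsAffineOpen (X.basicOpen r) := hU.basicOpen r
      obtain ⟨n, hn⟩ := exists_pow_smul_mem_span V S hU r (fn V S s y) (fn_mem_span V S hWaff s y)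
      obtain ⟨x, hx⟩ := exists_fn_apply_eq V S hU ⟨y.1, X.basicOpen_le r y.2⟩ _ hn
      refine ⟨n, x, fn_apply_injective V S y ?_⟩
      change fn V S ((generatedSheaf V S).presheaf.map (homOfLE (X.basicOpen_le r)).op x) y =
        fn V S ((X.presheaf.map (homOfLE (X.basicOpen_le r)).op r ^ n) • s) y
      rw [fn_map, fn_smul, hx, map_pow, evalFn_map, ← map_pow, evalFn_smul_eq_base_smul]
  · intro U hU r x W hWU hrW hx
    rcases isEmpty_or_nonempty W with hWe | ⟨⟨y⟩⟩
    · -- `D(r) ⊆ W = ∅` forces `r = 0`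
      have hbot : X.basicOpen r = ⊥ :=
        le_bot_iff.mp fun z hz => (hWe.false ⟨z, hrW hz⟩).elim
      refine ⟨1, ?_⟩
      rw [(basicOpen_eq_bot_iff r).mp hbot, pow_one, zero_smul]
    · exact ⟨0, by rw [pow_zero, one_smul]; exact eq_zero_of_map_eq_zero V S (homOfLE hWU) y x hx⟩

/-- **`𝒪_X · S` is coherent for finite `S`** on a locally Noetherian integral `X`
(`Morphisms/DevissageClass.Coh` = affine-localizing + affine-finite type). [folklore] -/
theorem coh_generatedSheaf (hS : S.Finite) :
    Literature.AlgebraicGeometry.Morphisms.Coh (generatedSheaf (X := X) V S) :=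
  ⟨isAffineLocalizing_generatedSheaf V S, isAffineFiniteType_generatedSheaf V S hS⟩

end Summit.ResolutionOfSingularities.ResolutionOfSingularities.Theorems.NoZeno.SandwichCluster.FullSheaf

end
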